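import Literature.IUT.HodgeTheaters.PadicFrobenioidTMPairIntegrality
import Literature.AlgebraicGeometry.Frobenioids.PadicFrobenioidPairIsoOrientation
import HarnessLib

/-!
# The Ψ-induced pair of an EQUIVALENCE of `p`-adic Frobenioids as an [AbsTopIII] Def 3.1 `TM`-pair isomorphism with
# TWO-SIDED integrality — abc-iut-L1's orientation theorem `exists_pairIso_fbarUnits_integral` knit with «N3b» (p494180)
# (cell abc-iut, L5 hub node IUTchI:Cor5.3(ii), SUBDAG-IUTchI-Cor53 v1.1 §R; L5 ROWS #5 row R8, holder's ruling
# 2026-08-27T04:00:09Z «w4-d054 files the L1-level knit»; PROOF-ONLY, no definition)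

S. Mochizuki, *Inter-universal Teichmüller theory I*, kurims manuscript (May 2020), proof of Corollary 5.3 (ii), p. 144
l. 36–39: «it follows from [AbsTopIII], Proposition 3.2, (iv) … that the natural map from isomorphisms `¹ℱ_v ⥲ ²ℱ_v` to
isomorphisms `¹𝒟_v ⥲ ²𝒟_v` is bijective at `v ∈ 𝕍^non`» ([IUTchI] Cor 5.3 (ii) p.144) [claim: Mochizuki2012, status: disputed]
(D-0012 claim key; series status DISPUTED — this file COMPOSES landed theorems about OUR interfaces; nothing of the series is
asserted and no side is taken on [IUTchIII] Cor. 3.12).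
S. Mochizuki, *The geometry of Frobenioids II*, Kyushu J. Math. 62 (2008), Thm 2.4 (ii) p. 21: «`Ψ` induces a pair of
compatible isomorphisms `G₁ ⥲ G₂`; `K̄₁^× ⥲ K̄₂^×`» [cite: MochizukiFrdII2008, Thm 2.4 (ii) p.21]; proof of Thm 2.4, p. 20
ll. 21–27: «`Ψ` preserves `O^▷(−)` [cf. [Mzk5], Cor. 4.10, Cor. 4.11, (iii)]» [cite: MochizukiFrdII2008, Thm 2.4 (i) p.20].
S. Mochizuki, *Topics in absolute anabelian geometry III*, Def 3.1 (i)(ii) pp. 66–67 («`(Π ↷ M)` … `T = TM`»)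
[cite: MochizukiAbsTopIII2015, Definition 3.1 (ii) p.67].

## What is proved (two compositions, every hypothesis = abc-iut-L1's, VERBATIM)

abc-iut-L1's `BaseGaloisSystem.exists_pairIso_fbarUnits_integral` (`PadicFrobenioidPairIsoOrientation.lean`): for fieldwise
saturated `pᵢ`-adic Frobenioid data `dᵢ` over the genuine §2 bases `φᵢ : Πᵢ → G_{ℚ_{pᵢ}}` (open homomorphisms, `Πᵢ` tempered),
an equivalence of bases `E = Ψ^Base` with the slot `Ψ_B : B₁ ≅ E^op ⋙ B₂`, a cofinal tower `N` for `Π₁`, and the [FrdI]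
Cor 4.11 orientation input `hpos` («`Ψ_B` carries elements with effective divisor to elements with effective divisor»), there is
a compatible pair (`φ : Π₁ ≃ₜ* Π₂` carrying `Ker φ₁` onto `Ker φ₂`, `ψ : φ₁(Π₁) ⥲ φ₂(Π₂)`, `ψ̄ : ℚ̄_{p₁}^× ⥲ ℚ̄_{p₂}^×`) with
ONE-SIDED integrality `‖a‖ ≤ 1 ⇒ ‖ψ̄ a‖ ≤ 1`.  abc-iut-w4-d077's `PadicTMPair.hint_of_oneSided` (p494180, «N3b CONVERSE-INTEGRALITY»:
one-sided integrality of a unit-group isomorphism onto `ℚ̄_{p₂}^×` is two-sided) and `exists_tmPairIso_of_rangePair` (the pair in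
that literal shape IS a `TM`-pair isomorphism) are composed with it here, so that consumers of [IUTchI] Cor 5.3 (ii)'s
non-archimedean clause start from an EQUIVALENCE of `p`-adic Frobenioid data and receive, with NO integrality binder:

* `exists_pairIso_fbarUnits_integral_iff` — L1's conclusion with «→» upgraded to «↔»: `‖a‖ ≤ 1 ⇔ ‖ψ̄ a‖ ≤ 1`, and
  `‖a‖ = 1 ⇔ ‖ψ̄ a‖ = 1` (`ψ̄` carries `𝒪^⊳_{ℚ̄_{p₁}}` EXACTLY onto `𝒪^⊳_{ℚ̄_{p₂}}` and `𝒪^×` exactly onto `𝒪^×` — the unit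
  currency of the `hunit` slot of abc-iut-L5-t4's `Cor53.descend_injective_model_of_monoidRigid`);
* `exists_tmPairIso_of_padicFrobenioid_equivalence` — ∃ `φ`, `ψ̄`, and an isomorphism `e` of the `TM`-pairs
  `(Π₁ ↷ 𝒪^⊳_{ℚ̄_{p₁}}) ⥲ (Π₂ ↷ 𝒪^⊳_{ℚ̄_{p₂}})` (`PadicTMPair.tmPairOfGaloisHom`, p490952) with `Ker φ₁ ↦ Ker φ₂`, `e.isoPi = φ`,
  the `Π₁`-equivariance of `ψ̄` through `φ`, two-sided integrality, and `e.isoM = ψ̄` on `𝒪^⊳` — the input shape of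
  abc-iut-w4-d077's `tmPairIso_isoM_eq_of_isoPi_eq_of_isOpenHom` ([AbsTopIII] Prop 3.2 (iv) at a `p`-adic Frobenioid, p493397,
  NO `.TM` binder for open `φᵢ`).
Also the small unit-currency corollary `norm_eq_one_iff_of_oneSided` (`‖u‖ = 1 ⇔ ‖ψ̄ u‖ = 1` from one-sided integrality, via
p494180's generic lemmas applied to `u` and `u⁻¹`).

Nothing of L1 / w4-d077 / L4 is restated or edited (consumed BY NAME: `exists_pairIso_fbarUnits_integral`, `hint_of_oneSided`,
`units_norm_map_eq_one_of_norm_eq_one`, `exists_tmPairIso_of_rangePair`, `hequiv_of_rangeEquiv`, `tmPairOfGaloisHom`,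
`GaloisMonoidPair.Iso`).  No definition, instance, notation or `Prop` fact; the displayed binders are exactly L1's; typed ≠
proved elsewhere; binder ≠ fact.
-/

noncomputable section

namespace Literature.IUT.HodgeTheaters

open CategoryTheory Opposite Topology
open Literature.AlgebraicGeometry.Frobenioids Literature.AlgebraicGeometry.Frobenioids.QuasiTemperoid
open Literature.AlgebraicGeometry.Frobenioids.BaseGaloisSystem
open Literature.AnabelianGeometry.AbsoluteAnabelian Literature.AnabelianGeometry.SemiGraphs

namespace PadicTMPair

/-! ### §1. Units go exactly to units under one-sided integrality -/

section Units

variable {p₁ p₂ : ℕ} [Fact p₁.Prime] [Fact p₂.Prime]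

/-- **`𝒪^×` goes EXACTLY onto `𝒪^×`**: for a group isomorphism `ψ̄ : ℚ̄_{p₁}^× ⥲ ℚ̄_{p₂}^×` with ONE-SIDED integrality,
`‖u‖ = 1 ⇔ ‖ψ̄ u‖ = 1` (p494180's `units_norm_map_eq_one_of_norm_eq_one` for «→»; for «←» the same lemma for `ψ̄⁻¹`, whose
one-sided integrality is the converse half of `hint_of_oneSided`). [cite: MochizukiFrdII2008, Thm 2.4 (ii) p.21] -/
theorem norm_eq_one_iff_of_oneSided (ψbar : (Fbar ℚ_[p₁])ˣ ≃* (Fbar ℚ_[p₂])ˣ)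
    (h : ∀ u : (Fbar ℚ_[p₁])ˣ, ‖(show PadicAlgCl p₁ from (u : Fbar ℚ_[p₁]))‖ ≤ 1 →
      ‖(show PadicAlgCl p₂ from ((ψbar u : (Fbar ℚ_[p₂])ˣ) : Fbar ℚ_[p₂]))‖ ≤ 1)
    (u : (Fbar ℚ_[p₁])ˣ) :
    ‖(show PadicAlgCl p₁ from (u : Fbar ℚ_[p₁]))‖ = 1 ↔
      ‖(show PadicAlgCl p₂ from ((ψbar u : (Fbar ℚ_[p₂])ˣ) : Fbar ℚ_[p₂]))‖ = 1 := by
  refine ⟨fun hu => units_norm_map_eq_one_of_norm_eq_one (K₁ := PadicAlgCl p₁) (K₂ := PadicAlgCl p₂) ψbar h hu,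
    fun hψu => ?_⟩
  -- one-sided integrality of `ψ̄⁻¹` is the converse direction of `hint_of_oneSided`
  have hsymm : ∀ w : (Fbar ℚ_[p₂])ˣ, ‖(show PadicAlgCl p₂ from (w : Fbar ℚ_[p₂]))‖ ≤ 1 →
      ‖(show PadicAlgCl p₁ from ((ψbar.symm w : (Fbar ℚ_[p₁])ˣ) : Fbar ℚ_[p₁]))‖ ≤ 1 := fun w hw => by
    have h1 := (hint_of_oneSided ψbar h (ψbar.symm w)).mpr
    rw [MulEquiv.apply_symm_apply] at h1
    exact h1 hw
  have h2 := units_norm_map_eq_one_of_norm_eq_one (K₁ := PadicAlgCl p₂) (K₂ := PadicAlgCl p₁) ψbar.symm hsymm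
    (u := ψbar u) hψu
  rw [MulEquiv.symm_apply_apply] at h2
  exact h2

end Units

/-! ### §2. abc-iut-L1's orientation theorem, two-sided; the `TM`-pair isomorphism of a `p`-adic Frobenioid equivalence -/

section Equivalence

variable {p₁ p₂ : ℕ} [Fact p₁.Prime] [Fact p₂.Prime]
  {G : Type} [Group G] [TopologicalSpace G] [IsTopologicalGroup G] (hG : IsTempered G)
  {G₂ : Type} [Group G₂] [TopologicalSpace G₂] [IsTopologicalGroup G₂] (hG₂ : IsTempered G₂)
  (φ₁ : G →* GalFbar ℚ_[p₁]) (hφ₁ : IsOpenHom φ₁) (φ₂ : G₂ →* GalFbar ℚ_[p₂]) (hφ₂ : IsOpenHom φ₂)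
  (N : ℕ → OpenNormalSubgroup G) (hN : Antitone N)
  (d₁ : PadicFrd.Datum (CosetCat G) p₁) (d₂ : PadicFrd.Datum (CosetCat G₂) p₂)

include hG hG₂ hN in
/-- **[FrdII] Thm 2.4 (ii) with the orientation input, TWO-SIDED.**  Under the hypotheses of abc-iut-L1's
`exists_pairIso_fbarUnits_integral` VERBATIM, the Ψ-induced pair (`φ`, `ψ`, `ψ̄`) has `ψ̄` carrying the `p₁`-adic integers of
`ℚ̄_{p₁}` EXACTLY onto the `p₂`-adic integers of `ℚ̄_{p₂}` (`‖a‖ ≤ 1 ⇔ ‖ψ̄ a‖ ≤ 1`) and units exactly onto units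
(`‖a‖ = 1 ⇔ ‖ψ̄ a‖ = 1`) — «`Ψ` preserves `O^▷(−)`» and `𝒪^×(−)` as EQUALITIES of the transported subsets.
[cite: MochizukiFrdII2008, Thm 2.4 (ii) p.21] -/
theorem exists_pairIso_fbarUnits_integral_iff
    (hd₁ : d₁.base = CosetCat.push φ₁ hφ₁.isOpenMap ⋙ CosetCat.toConnected (isTempered_galFbar ℚ_[p₁]) ⋙
      galoisPadicFields p₁)
    (hd₂ : d₂.base = CosetCat.push φ₂ hφ₂.isOpenMap ⋙ CosetCat.toConnected (isTempered_galFbar ℚ_[p₂]) ⋙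
      galoisPadicFields p₂)
    (hfs₁ : d₁.IsFieldwiseSaturated) (hfs₂ : d₂.IsFieldwiseSaturated)
    (E : CosetCat G ≌ CosetCat G₂) (ΨB : d₁.B ≅ E.functor.op ⋙ d₂.B)
    (hNb : ∀ U ∈ 𝓝 (1 : G), ∃ k, (N k : Set G) ⊆ U)
    (hpos : ∀ (k : ℕ) (b : d₁.B.obj (op (cQ (N k)))) (c : d₁.Φ.obj (op (cQ (N k)))),
      Literature.AlgebraicGeometry.Frobenioids.divB d₁.Φ d₁.B d₁.divB (op (cQ (N k))) b =
        Algebra.GrothendieckGroup.of c →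
      ∃ c₂ : d₂.Φ.obj (op (E.functor.obj (cQ (N k)))),
        Literature.AlgebraicGeometry.Frobenioids.divB d₂.Φ d₂.B d₂.divB (op (E.functor.obj (cQ (N k))))
          (ΨB.hom.app (op (cQ (N k))) b) = Algebra.GrothendieckGroup.of c₂) :
    ∃ (φ : G ≃ₜ* G₂) (ψ : φ₁.range ≃ₜ* φ₂.range) (ψbar : (Fbar ℚ_[p₁])ˣ ≃* (Fbar ℚ_[p₂])ˣ),
      φ₁.ker.map φ.toMulEquiv.toMonoidHom = φ₂.ker ∧
      (∀ g : G, (ψ ⟨φ₁ g, ⟨g, rfl⟩⟩ : GalFbar ℚ_[p₂]) = φ₂ (φ g)) ∧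
      (∀ (σ : φ₁.range) (u : (Fbar ℚ_[p₁])ˣ),
        ψbar (Units.map ((σ : GalFbar ℚ_[p₁]) : Fbar ℚ_[p₁] →* Fbar ℚ_[p₁]) u) =
          Units.map (((ψ σ : φ₂.range) : GalFbar ℚ_[p₂]) : Fbar ℚ_[p₂] →* Fbar ℚ_[p₂]) (ψbar u)) ∧
      (∀ u : (Fbar ℚ_[p₁])ˣ, ‖(show PadicAlgCl p₁ from (u : Fbar ℚ_[p₁]))‖ ≤ 1 ↔
        ‖(show PadicAlgCl p₂ from ((ψbar u : (Fbar ℚ_[p₂])ˣ) : Fbar ℚ_[p₂]))‖ ≤ 1) ∧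
      ∀ u : (Fbar ℚ_[p₁])ˣ, ‖(show PadicAlgCl p₁ from (u : Fbar ℚ_[p₁]))‖ = 1 ↔
        ‖(show PadicAlgCl p₂ from ((ψbar u : (Fbar ℚ_[p₂])ˣ) : Fbar ℚ_[p₂]))‖ = 1 := by
  obtain ⟨φ, ψ, ψbar, hker, hψ, hequiv, hint⟩ :=
    exists_pairIso_fbarUnits_integral hG hG₂ φ₁ hφ₁ φ₂ hφ₂ N hN d₁ d₂ hd₁ hd₂ hfs₁ hfs₂ E ΨB hNb hpos
  exact ⟨φ, ψ, ψbar, hker, hψ, hequiv, hint_of_oneSided ψbar hint, norm_eq_one_iff_of_oneSided ψbar hint⟩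

include hG hG₂ hN in
/-- **The Ψ-induced pair of an equivalence of `p`-adic Frobenioids IS an isomorphism of the [AbsTopIII] Def 3.1 `TM`-pairs
`(Π₁ ↷ 𝒪^⊳_{ℚ̄_{p₁}}) ⥲ (Π₂ ↷ 𝒪^⊳_{ℚ̄_{p₂}})`, with NO integrality binder.**  Under the hypotheses of abc-iut-L1's
`exists_pairIso_fbarUnits_integral` VERBATIM there are `φ : Π₁ ≃ₜ* Π₂` carrying `Ker φ₁` onto `Ker φ₂`, the Ψ-induced
`ψ̄ : ℚ̄_{p₁}^× ⥲ ℚ̄_{p₂}^×` (`Π₁`-equivariant through `φ`, two-sided integral), and a `TM`-pair isomorphism `e` with Galois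
component `φ` and monoid component `ψ̄|_{𝒪^⊳}` — the input of `PadicTMPair.tmPairIso_isoM_eq_of_isoPi_eq_of_isOpenHom`
([AbsTopIII] Prop 3.2 (iv) at a `p`-adic Frobenioid: the monoid component is DETERMINED by `φ`).
[cite: MochizukiAbsTopIII2015, Definition 3.1 (ii) p.67] -/
theorem exists_tmPairIso_of_padicFrobenioid_equivalence
    (hd₁ : d₁.base = CosetCat.push φ₁ hφ₁.isOpenMap ⋙ CosetCat.toConnected (isTempered_galFbar ℚ_[p₁]) ⋙
      galoisPadicFields p₁)
    (hd₂ : d₂.base = CosetCat.push φ₂ hφ₂.isOpenMap ⋙ CosetCat.toConnected (isTempered_galFbar ℚ_[p₂]) ⋙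
      galoisPadicFields p₂)
    (hfs₁ : d₁.IsFieldwiseSaturated) (hfs₂ : d₂.IsFieldwiseSaturated)
    (E : CosetCat G ≌ CosetCat G₂) (ΨB : d₁.B ≅ E.functor.op ⋙ d₂.B)
    (hNb : ∀ U ∈ 𝓝 (1 : G), ∃ k, (N k : Set G) ⊆ U)
    (hpos : ∀ (k : ℕ) (b : d₁.B.obj (op (cQ (N k)))) (c : d₁.Φ.obj (op (cQ (N k)))),
      Literature.AlgebraicGeometry.Frobenioids.divB d₁.Φ d₁.B d₁.divB (op (cQ (N k))) b =
        Algebra.GrothendieckGroup.of c →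
      ∃ c₂ : d₂.Φ.obj (op (E.functor.obj (cQ (N k)))),
        Literature.AlgebraicGeometry.Frobenioids.divB d₂.Φ d₂.B d₂.divB (op (E.functor.obj (cQ (N k))))
          (ΨB.hom.app (op (cQ (N k))) b) = Algebra.GrothendieckGroup.of c₂) :
    ∃ (φ : G ≃ₜ* G₂) (ψbar : (Fbar ℚ_[p₁])ˣ ≃* (Fbar ℚ_[p₂])ˣ)
      (e : GaloisMonoidPair.Iso (tmPairOfGaloisHom φ₁ hφ₁.continuous) (tmPairOfGaloisHom φ₂ hφ₂.continuous)),
      φ₁.ker.map φ.toMulEquiv.toMonoidHom = φ₂.ker ∧ e.isoPi = φ ∧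
      (∀ (g : G) (u : (Fbar ℚ_[p₁])ˣ),
        ψbar (Units.map ((φ₁ g : GalFbar ℚ_[p₁]) : Fbar ℚ_[p₁] →* Fbar ℚ_[p₁]) u) =
          Units.map ((φ₂ (φ g) : GalFbar ℚ_[p₂]) : Fbar ℚ_[p₂] →* Fbar ℚ_[p₂]) (ψbar u)) ∧
      (∀ u : (Fbar ℚ_[p₁])ˣ, ‖(show PadicAlgCl p₁ from (u : Fbar ℚ_[p₁]))‖ ≤ 1 ↔
        ‖(show PadicAlgCl p₂ from ((ψbar u : (Fbar ℚ_[p₂])ˣ) : Fbar ℚ_[p₂]))‖ ≤ 1) ∧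
      ∀ x : ↥(nonzeroIntegers ℚ_[p₁] (Fbar ℚ_[p₁])),
        ((show ↥(nonzeroIntegers ℚ_[p₂] (Fbar ℚ_[p₂])) from e.isoM x) : Fbar ℚ_[p₂]) =
          ((ψbar (ModelMLFGaloisData.toUnit x) : (Fbar ℚ_[p₂])ˣ) : Fbar ℚ_[p₂]) := by
  obtain ⟨φ, ψ, ψbar, hker, hψ, hequiv, hint⟩ :=
    exists_pairIso_fbarUnits_integral hG hG₂ φ₁ hφ₁ φ₂ hφ₂ N hN d₁ d₂ hd₁ hd₂ hfs₁ hfs₂ E ΨB hNb hpos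
  obtain ⟨e, he, hex⟩ := exists_tmPairIso_of_rangePair φ₁ hφ₁ φ₂ hφ₂ φ ψ ψbar hψ hequiv hint
  exact ⟨φ, ψbar, e, hker, he, hequiv_of_rangeEquiv φ₁ φ₂ φ ψ ψbar hψ hequiv, hint_of_oneSided ψbar hint, hex⟩

end Equivalence

end PadicTMPair

end Literature.IUT.HodgeTheaters

end
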